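import Mathlib
import Summits.KontsevichZagierPeriods.Zeta5Search.QWedgeClosedFormProof
import Summits.KontsevichZagierPeriods.Zeta5Search.WedgeDictionaryQPartFace
import Summits.KontsevichZagierPeriods.Zeta5Search.WedgeDictionaryFull
import Summits.KontsevichZagierPeriods.Zeta5Search.WedgeDictionaryAllPartners
import HarnessLib

/-!
# The `Q`-half of the wide-region node `wedgeDictionaryFull` is a theorem; the node is its `I`-identity off the half box
# (cell `pub-zeta5`, seat ct-1 g22)

HONEST FRAMING: systematic search; no irrationality claim unless certified.  Identities between Brown–Zudilin's leading coefficient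
`Q(a)` (arXiv:2210.03391, (17); the tree's `QOf`) and the cell's own closed forms on the cell's own parameter region; no value of any
integral, no `γ`, nothing about `ζ(5)`; no `def`, no new node.

typer g3's `@[conjecture] wedgeDictionaryFull` (the planners' Conjecture 2 verbatim) is the wedge dictionary on the WIDE region
`Converges a`, `b(a) ≥ 0`, `d(b(a)) ≥ 0`, any partner `j ∈ [1,7]` — wider than the tree theorem `wedgeDictionary` (half box
`2b_i ≤ b₀ + 1`).  This file proves its FIRST CONJUNCT (`Q`-half) on the whole wide region and reduces the node to its second
conjunct (the `I`-identity) at the points off the half box: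

* `QWedgeClosedForm_wide` — CF-Q (`Q(a)·(factorials) = ± ∏(b₀−b_j)!·Ω(b)`) for `b(a) ≥ 0` and the six non-`E` pair sums `≤ b₀`:
  typer g6's proof of `QWedgeClosedForm_holds` VERBATIM — it used only the non-negativity half of its half-box hypothesis;
* `qPart_wide` — **`Q(a) = ρ(a)·M₃(b(a))` for EVERY convergent `a` with `b(a) ≥ 0`, `d ≥ 0`** (non-vanishing branch: CF-Q-wide with
  gen-1's box-wide CF-M3 `OmegaRec.casoratianClosedForm_holds`; vanishing branch: `QOf_eq_zero_of_nonEpair` and `casoratianVanishing_holds`);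
* `wedgeDictionaryFull_Q` — the node's `Q`-conjunct `Q(a) = ρ(a)·(U(b)W(b+e_j) − U(b+e_j)W(b))` on the whole wide region, every `j`;
* `wedgeDictionaryFull_iff_I_offHalfBox` — **`wedgeDictionaryFull` ⟺ the `I`-identity
  `I(a) = 2ρ·[(W′ − 2ζ(2)U′)·F̃₇(b) − (W − 2ζ(2)U)·F̃₇(b′)]` at the wide-region points with some `2b_i > b₀ + 1`** (with ct-1 g22's
  `wedgeDictionaryFull_iff_offHalfBox`).  That analytic residual is NOT proved here.
-/

noncomputable section

open Finset

namespace Summit.KontsevichZagierPeriods.Zeta5Search.WedgeDictionaryFullQ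

open Summit.KontsevichZagierPeriods.Zeta5Search.WedgeDictionary
open Summit.KontsevichZagierPeriods.Zeta5Search.CFQ
open Summit.KontsevichZagierPeriods.Zeta5Search.DualSeries
open Literature.NumberTheory.Irrationality.BrownZudilin2022 (bOfA Converges convergenceForms QOf vwpDual cellularIntegral)
open Literature.NumberTheory.Transcendental (zetaValue)

/-! ## 1. CF-Q on the wide region -/

/-- **CF-Q on the wide region**: for convergent `a` with `b(a)_i ≥ 0` (`i ∈ [1,7]`) and the six pair sums `b_j + b_k ≤ b₀`,
`(j,k) ∈ {16,17,27,35,45,46}`: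
`Q(a)·b₀!·b₁!b₄!b₅!b₆!b₇!·∏_{(j,k)}(b₀−b_j−b_k)! = (−1)^{b₀+Σb_j}·∏_j(b₀−b_j)!·Ω(b)` — typer g6's `QWedgeClosedForm_holds` with the
(unused) upper half-box bound and `d ≥ 0` dropped from the hypotheses; the proof is the same. [folklore] -/
theorem QWedgeClosedForm_wide (a : Fin 8 → ℤ) (hconv : Converges a) (hnn' : ∀ i ∈ Icc 1 7, 0 ≤ bOfA a i)
    (hne : ∀ jk ∈ nonEpairs, bOfA a jk.1 + bOfA a jk.2 ≤ bOfA a 0) :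
    (QOf a : ℚ) * ((((bOfA a 0).toNat.factorial : ℚ) *
        (([1, 4, 5, 6, 7] : List ℕ).map fun j => ((bOfA a j).toNat.factorial : ℚ)).prod) *
        (nonEpairs.map fun jk => ((bOfA a 0 - bOfA a jk.1 - bOfA a jk.2).toNat.factorial : ℚ)).prod) =
      (-1 : ℚ) ^ ((bOfA a 0).toNat + (∑ j ∈ range 7, bOfA a (j + 1)).toNat) *
        (∏ j ∈ range 7, ((bOfA a 0 - bOfA a (j + 1)).toNat.factorial : ℚ)) * omegaVWP (bOfA a) := by
  have hE := epairs_le_of_converges a hconv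
  have h12 := hE (1,2) (by simp [Epairs]); have h13 := hE (1,3) (by simp [Epairs])
  have h14 := hE (1,4) (by simp [Epairs]); have h15 := hE (1,5) (by simp [Epairs])
  have h23 := hE (2,3) (by simp [Epairs]); have h24 := hE (2,4) (by simp [Epairs])
  have h25 := hE (2,5) (by simp [Epairs]); have h26 := hE (2,6) (by simp [Epairs])
  have h34 := hE (3,4) (by simp [Epairs]); have h36 := hE (3,6) (by simp [Epairs])
  have h37 := hE (3,7) (by simp [Epairs]); have h47 := hE (4,7) (by simp [Epairs])
  have h56 := hE (5,6) (by simp [Epairs]); have h57 := hE (5,7) (by simp [Epairs])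
  have h67 := hE (6,7) (by simp [Epairs])
  have h16 := hne (1,6) (by simp [nonEpairs]); have h17 := hne (1,7) (by simp [nonEpairs])
  have h27 := hne (2,7) (by simp [nonEpairs]); have h35 := hne (3,5) (by simp [nonEpairs])
  have h45 := hne (4,5) (by simp [nonEpairs]); have h46 := hne (4,6) (by simp [nonEpairs])
  simp only at h12 h13 h14 h15 h23 h24 h25 h26 h34 h36 h37 h47 h56 h57 h67 h16 h17 h27 h35 h45 h46
  have hr1 := hnn' 1 (by simp); have hr2 := hnn' 2 (by simp); have hr3 := hnn' 3 (by simp)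
  have hr4 := hnn' 4 (by simp); have hr5 := hnn' 5 (by simp); have hr6 := hnn' 6 (by simp)
  have hr7 := hnn' 7 (by simp)
  have hnn : ∀ j, j ≤ 7 → 0 ≤ bOfA a j := by
    intro j hj
    interval_cases j
    · linarith
    all_goals assumption
  -- natural-number coordinates
  have hb0 : ((bN a 0 : ℕ) : ℤ) = bOfA a 0 := Int.toNat_of_nonneg (hnn 0 (by norm_num))
  have hb1 : ((bN a 1 : ℕ) : ℤ) = bOfA a 1 := Int.toNat_of_nonneg (hnn 1 (by norm_num))
  have hb2 : ((bN a 2 : ℕ) : ℤ) = bOfA a 2 := Int.toNat_of_nonneg (hnn 2 (by norm_num))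
  have hb3 : ((bN a 3 : ℕ) : ℤ) = bOfA a 3 := Int.toNat_of_nonneg (hnn 3 (by norm_num))
  have hb4 : ((bN a 4 : ℕ) : ℤ) = bOfA a 4 := Int.toNat_of_nonneg (hnn 4 (by norm_num))
  have hb5 : ((bN a 5 : ℕ) : ℤ) = bOfA a 5 := Int.toNat_of_nonneg (hnn 5 (by norm_num))
  have hb6 : ((bN a 6 : ℕ) : ℤ) = bOfA a 6 := Int.toNat_of_nonneg (hnn 6 (by norm_num))
  have hb7 : ((bN a 7 : ℕ) : ℤ) = bOfA a 7 := Int.toNat_of_nonneg (hnn 7 (by norm_num))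
  have hQ := QOf_eq_sign_mul_LsumZ a hnn h12 h36 h67 h16 h26 h46 h56
  have hΩ := omegaVWP_eq_OmegaQ a hnn
  set n := bN a 0 with hn
  set b := bN a with hbdef
  have hp : PairCond n b := by
    unfold PairCond; refine ⟨?_, ?_, ?_, ?_, ?_, ?_, ?_, ?_, ?_, ?_, ?_⟩ <;> omega
  have key := cfq_bform hp
  -- rewrite the statement in the coordinates `(n, b)`
  rw [hQ, hΩ]
  have t0 : (bOfA a 0).toNat = n := rfl
  have t1 : (bOfA a 1).toNat = b 1 := rfl
  have t4 : (bOfA a 4).toNat = b 4 := rfl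
  have t5 : (bOfA a 5).toNat = b 5 := rfl
  have t6 : (bOfA a 6).toNat = b 6 := rfl
  have t7 : (bOfA a 7).toNat = b 7 := rfl
  have d16 : (bOfA a 0 - bOfA a 1 - bOfA a 6).toNat = n - b 1 - b 6 := by omega
  have d17 : (bOfA a 0 - bOfA a 1 - bOfA a 7).toNat = n - b 1 - b 7 := by omega
  have d27 : (bOfA a 0 - bOfA a 2 - bOfA a 7).toNat = n - b 2 - b 7 := by omega
  have d35 : (bOfA a 0 - bOfA a 3 - bOfA a 5).toNat = n - b 3 - b 5 := by omega
  have d45 : (bOfA a 0 - bOfA a 4 - bOfA a 5).toNat = n - b 4 - b 5 := by omega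
  have d46 : (bOfA a 0 - bOfA a 4 - bOfA a 6).toNat = n - b 4 - b 6 := by omega
  have s1 : (bOfA a 0 - bOfA a 1).toNat = n - b 1 := by omega
  have s2 : (bOfA a 0 - bOfA a 2).toNat = n - b 2 := by omega
  have s3 : (bOfA a 0 - bOfA a 3).toNat = n - b 3 := by omega
  have s4 : (bOfA a 0 - bOfA a 4).toNat = n - b 4 := by omega
  have s5 : (bOfA a 0 - bOfA a 5).toNat = n - b 5 := by omega
  have s6 : (bOfA a 0 - bOfA a 6).toNat = n - b 6 := by omega
  have s7 : (bOfA a 0 - bOfA a 7).toNat = n - b 7 := by omega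
  have hS : (∑ j ∈ range 7, bOfA a (j + 1)).toNat = S7 b := by
    simp only [sum_range_succ, sum_range_zero, zero_add, Nat.reduceAdd]
    unfold S7; omega
  simp only [nonEpairs, List.map, List.prod_cons, List.prod_nil, prod_range_succ, prod_range_zero, one_mul,
    zero_add, Nat.reduceAdd, t0, t1, t4, t5, t6, t7, d16, d17, d27, d35, d45, d46, s1, s2, s3, s4, s5, s6, s7, hS]
  push_cast
  unfold fq at key
  linear_combination ((-1 : ℚ) ^ (n + S7 b)) * key

/-! ## 2. `Q(a) = ρ(a)·M₃(b(a))` on the wide region -/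

/-- Non-vanishing branch: for convergent `a` with `b(a) ≥ 0`, `d ≥ 0` and the six non-`E` pair sums `≤ b₀`,
`Q(a) = ρ(a)·M₃(b(a))` (CF-Q-wide divided by gen-1's box-wide CF-M3 `OmegaRec.casoratianClosedForm_holds`). [folklore] -/
theorem qPart_wide_of_nonEpairs (a : Fin 8 → ℤ) (hconv : Converges a) (hnn : ∀ i ∈ Icc 1 7, 0 ≤ bOfA a i)
    (hd : 0 ≤ dOf (bOfA a)) (hne : ∀ jk ∈ nonEpairs, bOfA a jk.1 + bOfA a jk.2 ≤ bOfA a 0) :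
    (QOf a : ℚ) = rhoOf a * quadM3 (bOfA a) := by
  obtain ⟨hIB, hle⟩ := inBox_of_full a hconv hnn
  have hall := allPairs_le_of_nonEpairs a hconv hne
  have hMa := OmegaRec.casoratianClosedForm_holds (bOfA a) hIB hd hle hall
  have h2 := QWedgeClosedForm_wide a hconv hnn hne
  have hX : ((((bOfA a 0).toNat.factorial : ℚ) *
      (([1, 4, 5, 6, 7] : List ℕ).map fun j => ((bOfA a j).toNat.factorial : ℚ)).prod) *
      (nonEpairs.map fun jk => ((bOfA a 0 - bOfA a jk.1 - bOfA a jk.2).toNat.factorial : ℚ)).prod) ≠ 0 := by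
    simp only [nonEpairs, List.map, List.prod_cons, List.prod_nil]
    positivity
  have hZ : (((bOfA a 0).toNat.factorial : ℚ) *
      (allPairs.map fun jk => ((bOfA a 0 - bOfA a jk.1 - bOfA a jk.2).toNat.factorial : ℚ)).prod) ≠ 0 := by
    simp only [allPairs, List.map, List.prod_cons, List.prod_nil]
    positivity
  have hq := eq_div_of_mul_eq hX h2
  have hm := eq_div_of_mul_eq hZ hMa
  rw [hq, hm]
  simp only [rhoOf, Epairs, allPairs, nonEpairs, List.map, List.prod_cons, List.prod_nil, mul_one, pow_add]
  field_simp

/-- Vanishing branch: if one of the six non-`E` pair sums exceeds `b₀`, both `Q(a)` and `M₃(b(a))` vanish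
(`QOf_eq_zero_of_nonEpair`, `casoratianVanishing_holds`). [folklore] -/
theorem qPart_wide_of_exceeding (a : Fin 8 → ℤ) (hconv : Converges a) (hnn : ∀ i ∈ Icc 1 7, 0 ≤ bOfA a i)
    (hd : 0 ≤ dOf (bOfA a)) (hex : ∃ jk ∈ nonEpairs, bOfA a 0 < bOfA a jk.1 + bOfA a jk.2) :
    (QOf a : ℚ) = rhoOf a * quadM3 (bOfA a) := by
  obtain ⟨hIB, hle⟩ := inBox_of_full a hconv hnn
  obtain ⟨jk, hjk, hlt⟩ := hex
  have hQ0 : QOf a = 0 := QOf_eq_zero_of_nonEpair a hconv ⟨jk, hjk, hlt⟩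
  have hjk' : jk ∈ allPairs := by
    simp only [nonEpairs, List.mem_cons, List.mem_nil_iff, or_false] at hjk
    rcases hjk with rfl | rfl | rfl | rfl | rfl | rfl <;> simp [allPairs]
  have hM0 : quadM3 (bOfA a) = 0 := casoratianVanishing_holds (bOfA a) hIB hd hle ⟨jk, hjk', hlt⟩
  simp [hQ0, hM0]

/-- **`Q(a) = ρ(a)·M₃(b(a))` on the WHOLE WIDE REGION**: for every convergent `a` with `b(a)_i ≥ 0` (`i ∈ [1,7]`) and `d(b(a)) ≥ 0`,
Brown–Zudilin's leading coefficient (17) is the cell's closed scalar times the `j`-free Casoratian `M₃` (the tree's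
`qPart_of_casoratianClosedForm` had this on the half box only). [folklore] -/
theorem qPart_wide (a : Fin 8 → ℤ) (hconv : Converges a) (hnn : ∀ i ∈ Icc 1 7, 0 ≤ bOfA a i) (hd : 0 ≤ dOf (bOfA a)) :
    (QOf a : ℚ) = rhoOf a * quadM3 (bOfA a) := by
  by_cases hex : ∃ jk ∈ nonEpairs, bOfA a 0 < bOfA a jk.1 + bOfA a jk.2
  · exact qPart_wide_of_exceeding a hconv hnn hd hex
  · have hne : ∀ jk ∈ nonEpairs, bOfA a jk.1 + bOfA a jk.2 ≤ bOfA a 0 := fun jk hjk => by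
      by_contra hc
      exact hex ⟨jk, hjk, by omega⟩
    exact qPart_wide_of_nonEpairs a hconv hnn hd hne

/-! ## 3. The node: its `Q`-half everywhere, and what remains -/

/-- **The `Q`-half of `wedgeDictionaryFull` holds on the whole wide region**: for convergent `a` with `b(a) ≥ 0`, `d ≥ 0` and EVERY
partner `j ∈ [1,7]`, `Q(a) = ρ(a)·(U(b)W(b+e_j) − U(b+e_j)W(b))`. [folklore] -/
theorem wedgeDictionaryFull_Q {a : Fin 8 → ℤ} (hconv : Converges a) (hnn : ∀ i ∈ Icc 1 7, 0 ≤ bOfA a i)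
    (hd : 0 ≤ dOf (bOfA a)) {j : ℕ} (hj : j ∈ Icc 1 7) :
    (QOf a : ℚ) = rhoOf a * (coeffU (bOfA a) * coeffW (Function.update (bOfA a) j (bOfA a j + 1)) -
        coeffU (Function.update (bOfA a) j (bOfA a j + 1)) * coeffW (bOfA a)) := by
  obtain ⟨hIB, hle⟩ := inBox_of_full a hconv hnn
  rw [wedgeQ_eq_quadM3' (bOfA a) hIB hd hj (hle j hj)]
  exact qPart_wide a hconv hnn hd

/-- **`wedgeDictionaryFull` IS its `I`-identity off the half box**: the node holds iff, at every convergent `a` with `b(a) ≥ 0`,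
`d ≥ 0`, some `2b_i > b₀ + 1`, and every `j ∈ [1,7]`,
`I(a) = 2ρ(a)·[(W(b′) − 2ζ(2)U(b′))·F̃₇(b) − (W(b) − 2ζ(2)U(b))·F̃₇(b′)]`, `b = b(a)`, `b′ = b + e_j`
(ct-1 g22's `wedgeDictionaryFull_iff_offHalfBox` with the `Q`-conjunct supplied by `wedgeDictionaryFull_Q`).  This residual is the
open analytic statement; nothing here proves it. [folklore] -/
theorem wedgeDictionaryFull_iff_I_offHalfBox :
    wedgeDictionaryFull ↔
      ∀ (a : Fin 8 → ℤ) (j : ℕ), j ∈ Icc 1 7 → Converges a → (∀ i ∈ Icc 1 7, 0 ≤ bOfA a i) → 0 ≤ dOf (bOfA a) →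
        (∃ i ∈ Icc 1 7, bOfA a 0 + 1 < 2 * bOfA a i) →
        cellularIntegral a =
          2 * (rhoOf a : ℝ) *
            (((coeffW (Function.update (bOfA a) j (bOfA a j + 1)) : ℝ) -
                  2 * zetaValue 2 * coeffU (Function.update (bOfA a) j (bOfA a j + 1))) * vwpDual 7 (bOfA a) -
              ((coeffW (bOfA a) : ℝ) - 2 * zetaValue 2 * coeffU (bOfA a)) *
                vwpDual 7 (Function.update (bOfA a) j (bOfA a j + 1))) := by
  rw [WedgeDictionaryAllPartners.wedgeDictionaryFull_iff_offHalfBox]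
  constructor
  · intro h a j hj hconv hnn hd hoff
    exact (h a j hj hconv hnn hd hoff).2
  · intro h a j hj hconv hnn hd hoff
    exact ⟨wedgeDictionaryFull_Q hconv hnn hd hj, h a j hj hconv hnn hd hoff⟩

end Summit.KontsevichZagierPeriods.Zeta5Search.WedgeDictionaryFullQ
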